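import Summits.ValiantsHypothesis.ValiantsHypothesis.Theorems.GrenetZeonDualUnipotentThreeHalvesHeavyTopE1Identity
import Summits.ValiantsHypothesis.ValiantsHypothesis.Theorems.GrenetZeonDualUnipotentThreeHalvesHeavyTopE2Identity
import Summits.ValiantsHypothesis.ValiantsHypothesis.Theorems.GrenetZeonDualUnipotentThreeHalvesHeavyTopLevelTwoTools
import Summits.ValiantsHypothesis.ValiantsHypothesis.Theorems.GrenetZeonDualUnipotentThreeHalvesHeavyTopCommonKernel

/-!
# `GrenetZeon.DualUnipotentThreeHalves` (stmt-ValiantsHypothesis-24318) — P-Q1 kernel port (lead-g2 `P-Q1-LEVEL2-PORTMAP.md` L2.5 + L2.7b):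
# LEVEL 2, FINAL STEP FROM THE CHART: `γ = 0`, column `0` of every `τ_j` is `τ_j(0,0)·e_0`, hence `V e_0 = 0` and `V` is REDUCIBLE

Experiment cell «val-heavytop-census» (D-0160), engine seat val-htc-eng-1 (g3), kit 0; split of record (lead g3 03:00:55Z; L2.5/L2.7b claimed by this seat
03:4xZ).  INPUT = what the Level-2 CHART (eng-2 g3, L2.0 ✓ `…HeavyTopInitialLift` + L2.7a `…HeavyTopLevelTwoChart`) delivers, stated LETTER-WISE so that
the hypotheses are as weak as the identities need: `V ≤ M_{s+1}(ℂ)` with `Z^s = 0` on `V`, the shift `A ∈ V` (`hA`), a cut `c`, the lift `Ê = E_{01} + γ ∈ V`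
(`γ` supported in column `ω`, rows in `[c, s−2]`), for `c < j < s` the lifts `ŵ_j = E_{ωj} + τ_j + γ_j ∈ V` (`τ_j` with zero row and column `ω`, `tr τ_j = 0`,
`τ_j(s−1, 0) = 0` — the envelope; `γ_j` in column `ω`), and `V = span G` where every other generator has ZERO COLUMN `0` (the shift, the exact `E_{iω}`,
the block-unit lifts `E_{ab} +` column-`ω` tail with `a < b`).

* `trace_pow_eq_zero_of_pow_eq_zero` — nilpotency bookkeeping (`Z^s = 0 ⇒ tr Z^k = 0`, `k ≥ 1`).
* ★ `gamma_eq_zero` (L2.5) — `γ = 0`: for `c ≤ q ≤ s−2`, eng-2 g3's ✓ `mixed_eq_zero (A) (Ê) (ŵ_{q+1}) (s)` (the one-`Ê`-one-`ŵ` words vanish since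
  `(A + zÊ + xŵ)^s = 0`) read at `(0, s−1)` through this seat's ✓ `E2_identity` gives `γ_{qω} + tr τ_{q+1} = 0`, and `tr τ_{q+1} = 0`.
* ★ `tau_col_zero` (L2.5) — `τ_j(k, 0) = 0` for `1 ≤ k ≤ s−1`: ✓ `trace_mixed_eq_zero (A) (Ê) (ŵ_j) (k)` read through ✓ `E1_identity` (with `γ = 0`) gives
  `τ_j(k,0) = 0` for `k ≤ s−2`; `k = s−1` is the envelope.
* ★★ `mulVec_single_zero_eq_zero` (L2.7b) — `∀ Z ∈ V, Z e_0 = 0`: every generator has `e_0` as an eigenvector (`Ê e_0 = 0`, `ŵ_j e_0 = τ_j(0,0) e_0`,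
  the rest kill `e_0`), `V` is nilpotent, ✓ `mulVec_eq_zero_of_span_eigen`.
* ★★★ `not_irreducible` — hence `¬ (∀ U, V-invariant → U = ⊥ ∨ U = ⊤)` (✓ `not_irreducible_of_common_kernel`), the `hι7`-shaped exit; for the
  ORIGINAL (un-conjugated) space use ✓ `not_irreducible_of_common_kernel_conj` with the `P` of ✓ `…HeavyTopJordanShift`.
No case split on the cell: for `c = s−1` there are no `ŵ_j` and no `q`, and the conclusion is the same (eng-2 g3's remark 03:33:15Z).

What remains for Q1 in the kernel: the chart itself (L2.7a, eng-2 g3) feeding these hypotheses from ✓ `…HeavyTopLevelOneSubspace` / `…HeavyTopInitialLift`,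
and the top-level composition (JordanShift ∘ LevelOne ∘ chart ∘ this file).  ι(7) ≤ 19 additionally needs the type-`(7)` half (Thm C(7)) and the MMS
nilindex reduction — NOT commissioned (R340 (3)).  Pure linear algebra; R2, 24318 OPEN / not moved; VP ≠ VNP NOT proved.
`--supports stmt-ValiantsHypothesis-24318 --as helper`.  No definitions, no named facts.
[lead-g2 Q1-PROOF §2; `P-Q1-LEVEL2-PORTMAP.md` (C) L2.5/L2.7; eng-2 g3 INBOX 03:26:59Z / 03:33:15Z (chart shapes); this seat]
-/

set_option linter.dupNamespace false
set_option autoImplicit false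

namespace Summit.ValiantsHypothesis.ValiantsHypothesis.Theorems.GrenetZeon.HeavyTopLevelTwoFinal

open Matrix
open scoped BigOperators
open Summit.ValiantsHypothesis.ValiantsHypothesis.Theorems.GrenetZeon.HeavyTopE1Identity (unit_apply E1_identity)
open Summit.ValiantsHypothesis.ValiantsHypothesis.Theorems.GrenetZeon.HeavyTopE2Identity (E2_identity)
open Summit.ValiantsHypothesis.ValiantsHypothesis.Theorems.GrenetZeon.HeavyTopLevelTwoTools (trace_mixed_eq_zero mixed_eq_zero)
open Summit.ValiantsHypothesis.ValiantsHypothesis.Theorems.GrenetZeon.HeavyTopCommonKernel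
  (mulVec_eq_zero_of_span_eigen not_irreducible_of_common_kernel mulVec_single_eq_smul_iff)

variable {s : ℕ}

/-! ## §1 Nilpotency bookkeeping -/

/-- In a space with `Z^s = 0`, every positive power of every member is trace-free. -/
theorem trace_pow_eq_zero_of_pow_eq_zero {n : Type*} [Fintype n] [DecidableEq n] (Z : Matrix n n ℂ) (s : ℕ) (hZ : Z ^ s = 0)
    (k : ℕ) (hk : 1 ≤ k) : Matrix.trace (Z ^ k) = 0 := by
  have hnil : IsNilpotent (Z ^ k) := by
    refine ⟨s, ?_⟩
    rw [← pow_mul, mul_comm, pow_mul, hZ, zero_pow (by omega)]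
  exact (Matrix.isNilpotent_trace_of_isNilpotent hnil).eq_zero

/-! ## §2 The chart hypotheses, letter-wise (what L2.7a delivers), and the two consequences (E2) ⇒ `γ = 0`, (E1) ⇒ column `0` of `τ_j` -/

section Chart

variable (hs : 2 ≤ s) (V : Submodule ℂ (Matrix (Fin (s + 1)) (Fin (s + 1)) ℂ)) (hV : ∀ Z ∈ V, Z ^ s = 0)
  (A : Matrix (Fin (s + 1)) (Fin (s + 1)) ℂ) (hA : ∀ i j : Fin (s + 1), A i j = if (j : ℕ) = i + 1 ∧ (j : ℕ) < s then 1 else 0)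
  (hAV : A ∈ V) (c : ℕ)
  (γ : Matrix (Fin (s + 1)) (Fin (s + 1)) ℂ) (hγcol : ∀ p r, r ≠ Fin.last s → γ p r = 0)
  (hγrows : ∀ p : Fin (s + 1), ((p : ℕ) < c ∨ s - 1 ≤ (p : ℕ)) → γ p (Fin.last s) = 0)
  (hEV : vecMulVec (Pi.single (0 : Fin (s + 1)) (1 : ℂ)) (Pi.single (⟨1, by omega⟩ : Fin (s + 1)) (1 : ℂ)) + γ ∈ V)
  (τ γw : ℕ → Matrix (Fin (s + 1)) (Fin (s + 1)) ℂ)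
  (hτrow : ∀ j, c < j → j < s → ∀ l, τ j (Fin.last s) l = 0) (hτcol : ∀ j, c < j → j < s → ∀ l, τ j l (Fin.last s) = 0)
  (hτtr : ∀ j, c < j → j < s → Matrix.trace (τ j) = 0) (hτcorner : ∀ j, c < j → j < s → τ j ⟨s - 1, by omega⟩ 0 = 0)
  (hγwcol : ∀ j, c < j → j < s → ∀ p r, r ≠ Fin.last s → γw j p r = 0)
  (hwV : ∀ (j : ℕ) (_ : c < j) (hjs : j < s),
    vecMulVec (Pi.single (Fin.last s) (1 : ℂ)) (Pi.single (⟨j, by omega⟩ : Fin (s + 1)) (1 : ℂ)) + τ j + γw j ∈ V)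

include hs hV hA hAV hγcol hγrows hEV hτrow hτcol hτtr hτcorner hγwcol hwV

omit hτcol hτcorner in
/-- ★ **(E2) ⇒ `γ = 0`** (port map L2.5 `gamma_eq_zero`): the lift of `E_{01}` is exact, `Ê = E_{01} ∈ V`. [this file] -/
theorem gamma_eq_zero : γ = 0 := by
  have hγω : γ (Fin.last s) (Fin.last s) = 0 := hγrows _ (Or.inr (by simp))
  -- the column-`ω` entries in rows `c ≤ q ≤ s−2` die by (E2)
  have key : ∀ q : ℕ, c ≤ q → (hq : q + 2 ≤ s) → γ ⟨q, by omega⟩ (Fin.last s) = 0 := by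
    intro q hcq hq
    have hj : c < q + 1 := by omega
    have hjs : q + 1 < s := by omega
    have hmix := mixed_eq_zero A
      (vecMulVec (Pi.single (0 : Fin (s + 1)) (1 : ℂ)) (Pi.single (⟨1, by omega⟩ : Fin (s + 1)) (1 : ℂ)) + γ)
      (vecMulVec (Pi.single (Fin.last s) (1 : ℂ)) (Pi.single (⟨q + 1, by omega⟩ : Fin (s + 1)) (1 : ℂ)) + τ (q + 1) + γw (q + 1)) s
      (fun x z => hV _ (V.add_mem (V.add_mem hAV (V.smul_mem z hEV)) (V.smul_mem x (hwV (q + 1) hj hjs))))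
    have h0 := congrFun (congrFun hmix 0) ⟨s - 1, by omega⟩
    rw [E2_identity hs A hA q hq (τ (q + 1)) (γw (q + 1)) γ (hτrow _ hj hjs) (hγwcol _ hj hjs) hγcol, Matrix.zero_apply,
      hτtr _ hj hjs, add_zero] at h0
    exact h0
  ext p r
  rw [Matrix.zero_apply]
  by_cases hr : r = Fin.last s
  · rw [hr]
    by_cases hp : (p : ℕ) < c ∨ s - 1 ≤ (p : ℕ)
    · exact hγrows p hp
    · push Not at hp
      have hp' : p = ⟨(p : ℕ), by omega⟩ := Fin.ext rfl
      rw [hp']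
      exact key p hp.1 (by omega)
  · exact hγcol p r hr

/-- ★ **(E1) ⇒ column `0` of `τ_j` vanishes below the diagonal** (port map L2.5 `tau_col0_eq`): `τ_j(k, 0) = 0` for `1 ≤ k ≤ s − 1`
(`k ≤ s−2` by (E1) with `γ = 0`, `k = s−1` from the envelope `T`). [this file] -/
theorem tau_col_zero (j : ℕ) (hcj : c < j) (hjs : j < s) (k : ℕ) (hk1 : 1 ≤ k) (hks : k ≤ s - 1) : τ j ⟨k, by omega⟩ 0 = 0 := by
  rcases Nat.lt_or_ge k (s - 1) with hlt | hge
  · -- (E1) at `k + 1`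
    have hγ0 := gamma_eq_zero hs V hV A hA hAV c γ hγcol hγrows hEV τ γw hτrow hτtr hγwcol hwV
    have htr := trace_mixed_eq_zero A
      (vecMulVec (Pi.single (0 : Fin (s + 1)) (1 : ℂ)) (Pi.single (⟨1, by omega⟩ : Fin (s + 1)) (1 : ℂ)) + γ)
      (vecMulVec (Pi.single (Fin.last s) (1 : ℂ)) (Pi.single (⟨j, by omega⟩ : Fin (s + 1)) (1 : ℂ)) + τ j + γw j) k
      (fun x z => trace_pow_eq_zero_of_pow_eq_zero _ s
        (hV _ (V.add_mem (V.add_mem hAV (V.smul_mem z hEV)) (V.smul_mem x (hwV j hcj hjs)))) (k + 1) (by omega))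
    have hE1 := E1_identity hs A hA ⟨j, by omega⟩ (by simp only; exact hjs) (τ j) (γw j) γ (hτrow j hcj hjs) (hτcol j hcj hjs)
      (hγwcol j hcj hjs) hγcol (by rw [hγ0, Matrix.zero_apply]) (k + 1) (by omega) (by omega)
    simp only [Nat.add_sub_cancel] at hE1
    rw [hE1, hγ0] at htr
    simp only [Matrix.zero_apply, dite_eq_ite, ite_self, add_zero] at htr
    exact htr
  · have hk : k = s - 1 := by omega
    subst hk
    exact hτcorner j hcj hjs

/-! ## §3 Level 2, final: `V e_0 = 0`, hence `V` is reducible -/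

/-- ★★ **LEVEL 2 (port map L2.7b): `V e_0 = 0`.**  If moreover `V` is SPANNED by the chart lifts — `Ê`, the `ŵ_j` (`c < j < s`), and generators with
zero column `0` (the shift `A`, the exact `E_{iω}`, the block-unit lifts `E_{ab} +` column-`ω` tail, `a < b`) — then every member of `V` kills `e_0`:
each generator has `e_0` as an eigenvector (`Ê e_0 = 0` as `γ = 0`; `ŵ_j e_0 = τ_j(0,0) e_0` by `tau_col_zero`; the rest by hypothesis) and `V` is
nilpotent (✓ `mulVec_eq_zero_of_span_eigen`). [lead-g2 Q1-PROOF §2 «eigenvector lemma and conclusion»; this file] -/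
theorem mulVec_single_zero_eq_zero (G : Set (Matrix (Fin (s + 1)) (Fin (s + 1)) ℂ)) (hVG : V = Submodule.span ℂ G)
    (hG : ∀ M ∈ G, M = vecMulVec (Pi.single (0 : Fin (s + 1)) (1 : ℂ)) (Pi.single (⟨1, by omega⟩ : Fin (s + 1)) (1 : ℂ)) + γ ∨
      (∃ (j : ℕ) (_ : c < j) (hjs : j < s), M = vecMulVec (Pi.single (Fin.last s) (1 : ℂ)) (Pi.single (⟨j, by omega⟩ : Fin (s + 1)) (1 : ℂ)) + τ j + γw j) ∨
      (∀ i, M i 0 = 0)) :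
    ∀ Z ∈ V, Z *ᵥ Pi.single (0 : Fin (s + 1)) (1 : ℂ) = 0 := by
  have hγ0 := gamma_eq_zero hs V hV A hA hAV c γ hγcol hγrows hEV τ γw hτrow hτtr hγwcol hwV
  have h0ω : (0 : Fin (s + 1)) ≠ Fin.last s := fun h => by have := congrArg Fin.val h; simp at this; omega
  refine mulVec_eq_zero_of_span_eigen G V hVG (fun Z hZ => ⟨s, hV Z hZ⟩) _ (by
    intro h; have := congrFun h 0; simp at this) ?_
  intro M hM
  rcases hG M hM with rfl | ⟨j, hcj, hjs, rfl⟩ | hcol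
  · -- `Ê = E_{01}`: zero column `0`
    refine ⟨0, (mulVec_single_eq_smul_iff _ 0 0).2 fun i => ?_⟩
    have hne : ¬ (i = 0 ∧ (0 : Fin (s + 1)) = ⟨1, by omega⟩) := fun h => absurd (congrArg Fin.val h.2) (by simp)
    rw [hγ0, add_zero, unit_apply, if_neg hne, ite_self]
  · -- `ŵ_j`: column `0` is `τ_j(0,0) e_0`
    refine ⟨τ j 0 0, (mulVec_single_eq_smul_iff _ 0 _).2 fun i => ?_⟩
    rw [Matrix.add_apply, Matrix.add_apply, unit_apply, hγwcol j hcj hjs i 0 h0ω, add_zero]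
    by_cases hi : i = 0
    · subst hi
      rw [if_neg, zero_add, if_pos rfl]
      rintro ⟨h, -⟩
      exact h0ω h
    · rw [if_neg hi, if_neg, zero_add]
      · by_cases hiω : i = Fin.last s
        · rw [hiω, hτrow j hcj hjs]
        · have hi' : (i : ℕ) < s := by
            have := i.isLt
            have : (i : ℕ) ≠ s := fun e => hiω (Fin.ext (by simpa using e))
            omega
          have hi1 : 1 ≤ (i : ℕ) := by
            rcases Nat.eq_zero_or_pos (i : ℕ) with h | h
            · exact absurd (Fin.ext (by simpa using h)) hi
            · exact h
          have := tau_col_zero hs V hV A hA hAV c γ hγcol hγrows hEV τ γw hτrow hτcol hτtr hτcorner hγwcol hwV j hcj hjs i hi1 (by omega)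
          have hi'' : (⟨(i : ℕ), by omega⟩ : Fin (s + 1)) = i := Fin.ext rfl
          rwa [hi''] at this
      · rintro ⟨-, h⟩
        have := congrArg Fin.val h
        simp at this
        omega
  · refine ⟨0, (mulVec_single_eq_smul_iff _ 0 0).2 fun i => ?_⟩
    rw [hcol i, ite_self]

/-- ★★★ **LEVEL 2 ⇒ REDUCIBLE** (port map L2.7 exit): under the chart hypotheses and the spanning hypothesis, `V` is NOT irreducible in the ι-currency
predicate of ✓ `heavyTopInst_five_seven_of_iota7` — the line `ℂe_0` is invariant.  (Conjugation back to the original space: ✓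
`not_irreducible_of_common_kernel_conj`.) [this file] -/
theorem not_irreducible (G : Set (Matrix (Fin (s + 1)) (Fin (s + 1)) ℂ)) (hVG : V = Submodule.span ℂ G)
    (hG : ∀ M ∈ G, M = vecMulVec (Pi.single (0 : Fin (s + 1)) (1 : ℂ)) (Pi.single (⟨1, by omega⟩ : Fin (s + 1)) (1 : ℂ)) + γ ∨
      (∃ (j : ℕ) (_ : c < j) (hjs : j < s), M = vecMulVec (Pi.single (Fin.last s) (1 : ℂ)) (Pi.single (⟨j, by omega⟩ : Fin (s + 1)) (1 : ℂ)) + τ j + γw j) ∨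
      (∀ i, M i 0 = 0)) :
    ¬ ∀ U : Submodule ℂ (Fin (s + 1) → ℂ), (∀ Z ∈ V, ∀ x ∈ U, Z *ᵥ x ∈ U) → U = ⊥ ∨ U = ⊤ :=
  not_irreducible_of_common_kernel (by omega) V (Pi.single 0 1) (by intro h; have := congrFun h 0; simp at this)
    (mulVec_single_zero_eq_zero hs V hV A hA hAV c γ hγcol hγrows hEV τ γw hτrow hτcol hτtr hτcorner hγwcol hwV G hVG hG)

end Chart

end Summit.ValiantsHypothesis.ValiantsHypothesis.Theorems.GrenetZeon.HeavyTopLevelTwoFinal
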